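import Mathlib
import HarnessLib
import Summits.NavierStokesRegularity.NavierStokesRegularity.Theses.LocalVelCompTubeDoor
import Summits.NavierStokesRegularity.NavierStokesRegularity.Theorems.LocalVelCompTubeDoorLocalPointZoomVelSlices
import Summits.NavierStokesRegularity.NavierStokesRegularity.Theorems.LocalVelCompTubeDoorVelCompWindowRigidity

/-!
# Route `LocalVelCompTubeDoor` (S10, rung N0-LocalTubeDoorVelComp) — the rung leaf TARGET is a THEOREM

Cell ns-regularity-ideate, seat p6 (birth filing; the route was opened 2026-08-26T18:03Z from nsreg-p1's staged package).
Both cruxes of the route were landed VERBATIM as theorems while the route was staged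
(`…Theorems.LocalVelCompTubeDoorLocalPointZoomVelSlices.localPointZoomVelSlices`, p433414, and
`…Theorems.LocalVelCompTubeDoorVelCompWindowRigidity.velCompWindowRigidity`, p433644); this file records the leaf BY NAME
against the born Theses decl (closing item stmt-NavierStokesRegularity-19911; capstone for `route close --proved`).

WHAT THIS IS NOT: not a claim about Navier–Stokes regularity (Clay A).  The leaf is a regularity CRITERION (local Type I
+ one fading Cartesian velocity component on one similarity window ⇒ backward bounded), one rung of LADDER-NS N0;
establishment in the cell's sense still requires the cross-family referee PASS + independent reproduction.
-/

noncomputable section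

-- the summit and its single sub-problem share the name (CONVENTIONS §1), as in every Theorems file
set_option linter.dupNamespace false

namespace Summit.NavierStokesRegularity.NavierStokesRegularity.Theorems.LocalVelCompTubeDoorTarget

open Summit.NavierStokesRegularity.NavierStokesRegularity.Theses.LocalVelCompTubeDoor
open Summit.NavierStokesRegularity.NavierStokesRegularity.Theorems.LocalVelCompTubeDoorLocalPointZoomVelSlices
open Summit.NavierStokesRegularity.NavierStokesRegularity.Theorems.LocalVelCompTubeDoorVelCompWindowRigidity

/-- **The rung leaf `Target` (item stmt-NavierStokesRegularity-19911, rung N0-LocalTubeDoorVelComp) is a THEOREM**: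
`closes` applied to the two crux theorems (both cruxes unfolded to their landed statements). -/
theorem target_proof :
    Summit.NavierStokesRegularity.NavierStokesRegularity.Theses.LocalVelCompTubeDoor.Target :=
  closes
    (by
      unfold Summit.NavierStokesRegularity.NavierStokesRegularity.Theses.LocalVelCompTubeDoor.LocalPointZoomVelSlices
      exact localPointZoomVelSlices)
    (by
      unfold Summit.NavierStokesRegularity.NavierStokesRegularity.Theses.LocalVelCompTubeDoor.VelCompWindowRigidity
      exact velCompWindowRigidity)

end Summit.NavierStokesRegularity.NavierStokesRegularity.Theorems.LocalVelCompTubeDoorTarget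

end
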